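import Summits.CriticalPhenomena.PercolationContinuityZ3.Theorems.PercNearOneGluingNoHeavyPcintChordDiagramLaw
import Summits.CriticalPhenomena.PercolationContinuityZ3.Theorems.PercNearOneGluingNoHeavyPcintMemCountBinomial
import HarnessLib

/-!
# CriticalPhenomena/PercolationContinuityZ3 — Theorems/PercNearOneGluingNoHeavyPcintClosingCountBinomial.lean: the polygon counts are BINOMIAL POLYNOMIALS in the dimension — `closingCount d τ = Σ_j C(d,j)·fullClosingCount j τ`

Lane prim-pcint, STRUCTURE rule (prim-pcint-2 GEN 20; step F3 of the proof of STRUCTURE law C5-L1 `polygonLeadingCoeffLaw` for all `m`).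
The closing words of …PcintLoopExclusionLaw (`closingCount d τ = #nearWords d τ (τ−1)`: self-avoiding words of length `τ − 1` ending next to the
origin = rooted oriented `τ`-gons) are sorted by the set of axes they use, exactly as the memory words in …PcintMemCountBinomial: relabelling the
axes along an injection preserves self-avoidance (`isSAW_relabel_iff`) and the `ℓ¹`-norm of every position (`l1_embedSite`), so the closing words
of `ℤ^d` using exactly the axis set `A` are counted by **`fullClosingCount |A| τ`** = the number of closing words of `ℤ^{|A|}` using ALL axes
(`card_filter_axes_eq_closing`), and
**`closingCount d τ = Σ_{j ≤ τ−1} C(d, j) · fullClosingCount j τ`** for EVERY `d` (`closingCount_eq_sum_choose`).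
The sequel …PcintClosingWordChords evaluates the top coefficient: `fullClosingCount m (2m) = m!·2^m·a(m)` and `fullClosingCount j (2m) = 0`
for `j > m`.

HONEST FRAMING: elementary combinatorics (axis relabelling); no `sorry`; standard axioms.  Written by prim-pcint-2 gen 20, 2026-08-26.
-/

noncomputable section

open Literature.Probability.LatticeModels Literature.Probability.Percolation
open Summit.CriticalPhenomena.PercolationContinuityZ3.Theorems.Pcint

namespace Summit.CriticalPhenomena.PercolationContinuityZ3.Theorems.Pcint.MemoryTail

variable {j d n : ℕ}

/-! ### Relabelling preserves self-avoidance and `ℓ¹`-norms -/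

/-- **Relabelling preserves self-avoidance** (injective `ι`). [folklore] -/
theorem isSAW_relabel_iff {ι : Fin j → Fin d} (hι : Function.Injective ι) (u : Fin n → Fin j × Bool) :
    IsSAW (relabel ι u) ↔ IsSAW u := by
  unfold IsSAW
  simp only [wordPos_relabel hι, (embedSite_injective hι).eq_iff]

/-- The push-forward along an injection preserves the `ℓ¹` norm. [folklore] -/
theorem l1_embedSite {ι : Fin j → Fin d} (hι : Function.Injective ι) (x : Site j) : l1 (embedSite ι x) = l1 x := by
  classical
  unfold l1
  have hsplit : ∑ v, (embedSite ι x v).natAbs = ∑ v ∈ Finset.univ.image ι, (embedSite ι x v).natAbs := by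
    refine (Finset.sum_subset (Finset.subset_univ _) fun v _ hv => ?_).symm
    rw [embedSite_apply_of_forall_ne x (fun a h => hv (Finset.mem_image.2 ⟨a, Finset.mem_univ _, h⟩)), Int.natAbs_zero]
  rw [hsplit, Finset.sum_image fun a _ b _ h => hι h]
  exact Finset.sum_congr rfl fun a _ => by rw [embedSite_apply_image hι]

/-- Membership in `nearWords`. [folklore] -/
theorem mem_nearWords {τ m : ℕ} {w : Fin m → Fin d × Bool} : w ∈ nearWords d τ m ↔ IsSAW w ∧ l1 (wordPos w m) ≤ τ - m := by
  unfold nearWords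
  rw [Finset.mem_filter, mem_sawWords]

/-! ### Closing words using all axes -/

open Classical in
/-- **`fullClosingCount j τ`**: the number of self-avoiding words of length `τ − 1` on `ℤ^j` ending next to the origin that use ALL `j` axes
(rooted oriented `τ`-gons of `ℤ^j` spanning every direction). [folklore] -/
def fullClosingCount (j τ : ℕ) : ℕ := ((nearWords j τ (τ - 1)).filter fun u => axes u = Finset.univ).card

/-- `fullClosingCount j τ = 0` for `j > τ − 1` (a word of length `τ − 1` uses at most `τ − 1` axes). [folklore] -/
theorem fullClosingCount_eq_zero_of_lt {τ : ℕ} (hj : τ - 1 < j) : fullClosingCount j τ = 0 := by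
  classical
  unfold fullClosingCount
  rw [Finset.card_eq_zero, Finset.filter_eq_empty_iff]
  intro u _ hu
  have h1 := card_axes_le u
  rw [hu, Finset.card_univ, Fintype.card_fin] at h1
  omega

open Classical in
/-- **The closing words of `ℤ^d` using exactly the axis set `A` are counted by `fullClosingCount |A| τ`** (relabelling bijection along the
increasing enumeration of `A`). [folklore] -/
theorem card_filter_axes_eq_closing {τ : ℕ} (A : Finset (Fin d)) :
    ((nearWords d τ (τ - 1)).filter fun w => axes w = A).card = fullClosingCount A.card τ := by
  set m := A.card with hm
  let e : Fin m ≃o (A : Set (Fin d)) := A.orderIsoOfFin rfl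
  let ι : Fin m → Fin d := fun a => (e a : Fin d)
  have hιmem : ∀ a, ι a ∈ A := fun a => (e a).2
  have hι : Function.Injective ι := fun a b h => e.injective (Subtype.ext h)
  have hsurj : ∀ v ∈ A, ∃ a, ι a = v := fun v hv => ⟨e.symm ⟨v, hv⟩, by simp [ι]⟩
  unfold fullClosingCount
  symm
  refine Finset.card_bij (fun u _ => relabel ι u) ?_ ?_ ?_
  · -- maps into
    intro u hu
    rw [Finset.mem_filter, mem_nearWords] at hu ⊢
    refine ⟨⟨(isSAW_relabel_iff hι u).2 hu.1.1, ?_⟩, ?_⟩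
    · rw [wordPos_relabel hι, l1_embedSite hι]; exact hu.1.2
    · rw [axes_relabel, hu.2]
      ext v
      simp only [Finset.mem_image, Finset.mem_univ, true_and]
      exact ⟨fun ⟨a, ha⟩ => ha ▸ hιmem a, fun hv => hsurj v hv⟩
  · -- injective
    intro u₁ _ u₂ _ h
    funext t
    have ht := congrFun h t
    simp only [relabel, Prod.mk.injEq] at ht
    exact Prod.ext (hι ht.1) ht.2
  · -- surjective
    intro w hw
    rw [Finset.mem_filter, mem_nearWords] at hw
    have hwt : ∀ t, (w t).1 ∈ A := fun t => by
      rw [← hw.2]; exact Finset.mem_image_of_mem _ (Finset.mem_univ t)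
    let u : Fin (τ - 1) → Fin m × Bool := fun t => (e.symm ⟨(w t).1, hwt t⟩, (w t).2)
    have hwu : relabel ι u = w := by
      funext t
      simp [relabel, u, ι]
    refine ⟨u, ?_, hwu⟩
    rw [Finset.mem_filter, mem_nearWords]
    refine ⟨⟨?_, ?_⟩, ?_⟩
    · rw [← isSAW_relabel_iff hι u, hwu]; exact hw.1.1
    · rw [← l1_embedSite hι, ← wordPos_relabel hι, hwu]; exact hw.1.2
    · -- all axes of `Fin m` are used
      ext a
      simp only [Finset.mem_univ, iff_true, axes, Finset.mem_image, true_and]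
      have ha : ι a ∈ axes w := by rw [hw.2]; exact hιmem a
      obtain ⟨t, -, ht⟩ := Finset.mem_image.1 ha
      refine ⟨t, ?_⟩
      show e.symm ⟨(w t).1, hwt t⟩ = a
      apply e.injective
      rw [OrderIso.apply_symm_apply]
      exact Subtype.ext ht

/-- **The binomial expansion of the polygon counts**: `closingCount d τ = Σ_{j ≤ τ−1} C(d, j)·fullClosingCount j τ` for EVERY `d`. [folklore] -/
theorem closingCount_eq_sum_choose (d τ : ℕ) :
    closingCount d τ = ∑ j ∈ Finset.range (τ - 1 + 1), d.choose j * fullClosingCount j τ := by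
  classical
  unfold closingCount
  rw [Finset.card_eq_sum_card_fiberwise (f := axes) (t := (Finset.univ : Finset (Fin d)).powerset)
    (fun w _ => Finset.mem_powerset.2 (Finset.subset_univ _))]
  simp_rw [card_filter_axes_eq_closing]
  have hpc := Finset.sum_powerset_apply_card (fun c => fullClosingCount c τ) (x := (Finset.univ : Finset (Fin d)))
  simp only [Finset.card_univ, Fintype.card_fin, smul_eq_mul] at hpc
  rw [hpc]
  have key : ∀ N : ℕ, d ≤ N → τ - 1 ≤ N →
      ∑ j ∈ Finset.range (d + 1), d.choose j * fullClosingCount j τ = ∑ j ∈ Finset.range (N + 1), d.choose j * fullClosingCount j τ ∧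
      ∑ j ∈ Finset.range (τ - 1 + 1), d.choose j * fullClosingCount j τ =
        ∑ j ∈ Finset.range (N + 1), d.choose j * fullClosingCount j τ := by
    intro N hdN hnN
    constructor
    · refine Finset.sum_subset (Finset.range_subset_range.2 (by omega)) fun j hj hj' => ?_
      rw [Finset.mem_range] at hj hj'
      rw [Nat.choose_eq_zero_of_lt (by omega), zero_mul]
    · refine Finset.sum_subset (Finset.range_subset_range.2 (by omega)) fun j hj hj' => ?_
      rw [Finset.mem_range] at hj hj'
      rw [fullClosingCount_eq_zero_of_lt (by omega), mul_zero]
  obtain ⟨h1, h2⟩ := key (max d (τ - 1)) (le_max_left _ _) (le_max_right _ _)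
  rw [h1, h2]

/-- The binomial expansion in real form. [folklore] -/
theorem closingCount_eq_sum_choose_real (d τ : ℕ) :
    (closingCount d τ : ℝ) = ∑ j ∈ Finset.range (τ - 1 + 1), (d.choose j : ℝ) * (fullClosingCount j τ : ℝ) := by
  rw [closingCount_eq_sum_choose]; push_cast; rfl

end Summit.CriticalPhenomena.PercolationContinuityZ3.Theorems.Pcint.MemoryTail
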